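import Literature.IUT.LogVolume.Corollary22PartIILemmas
import HarnessLib

/-!
# The fork at [IUTchIII] Corollary 3.12, L-DH level, READING (U) — HONEST-SCOPE CERTIFICATE: the explicit height
# range in which the (U)-volume edge is proved (`LDHGenuineHullRegimeSlackExplicit`) is a range in which [IUTchIV]
# Thm. 1.10's display is CONTENT-FREE (abc-iut cell, crux ThetaPartII = stmt-ABC-19678, stub `stub_hullRegime` / VERDICT RISK ¶7)

Record-only file (D-0012) of the abc-iut cell (WAVE-3 discharge seat abc-iut-c312-d1, gen 5); TAKES NO SIDE on
[IUTchIII] Cor. 3.12 or on the (U)/(P) readings. abc-iut-c312-d1's `PointDict.hullVolumeAtDatum_BIII_of_logQAvoid_le_explicit`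
(LDHGenuineHullRegimeSlackExplicit) proves the (U)-volume body `Cor22.HullVolumeAtDatum P l (B_III P l)` — NO slot-constancy —
whenever `log(q^{∤{2,l}}(λ)) ≤ Θ_expl(P, l) := 40·log(d*·l)·(d*·l·log 2/(2·log(2·d*·l)) − C(P,l)/log 2)`,
`C(P,l) = 2·d_mod·(log-diff + log 𝔣^{∤{2,l}}) + log(30·l)`, `d* = 2^12·3^3·5·d_mod`. THIS FILE records, in the kernel, that the
slack paying for the slot residue there IS the additive constant of the conclusion: `Θ_expl(P,l) ≤ 20·log 2·d*·l < 120·d*·l`, so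
every point in that range satisfies [IUTchIV] Thm. 1.10's display `Cor22.Display P l η`
(`(1/6)·log q ≤ (1 + 20·d_mod/l)·(log-diff + log 𝔣) + 20·(d*·l + η)`, abc-iut-S-d2) OUTRIGHT, for every `η ≥ 0`, with no
appeal to Cor. 3.12 in any reading:

* `Cor22.explicitThreshold_le` — `Θ_expl(P, l) ≤ 20·log 2·(d*·l)`;
* `Cor22.display_of_logQAvoid_le_explicitThreshold` — `log(q^{∤{2,l}}(λ)) ≤ Θ_expl(P,l) → 0 ≤ η → Cor22.Display P l η`.

Reading for VERDICT RISK ¶7 (abc-iut-c312-d1 06:21Z): in reading (U), off the slot-constant regime, the kernel proves the volume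
edge (ii′) only in a height range where Thm. 1.10's display is content-free; wherever the display has content, (ii′)-(U) requires
`slotResidue ≤ B_III − δ_explicit` (abc-iut-S8: forced), an inequality of Szpiro type. Reading (P) is unaffected
(`stub_hullVolumePerImage` CLOSED). [cite: Mochizuki2012, IUTchIV Thm. 1.10 p. 22–23; Cor. 2.2 (ii) proof p. 46]
[claim: Mochizuki2012, status: disputed] for the IUT quotations; the content of this file is elementary real arithmetic.
-/

noncomputable section

namespace Literature.IUT.LogVolume

namespace Cor22

open Literature.NumberTheory.DiophantineGeometry.GenEll

variable {P : NFPoint} {l : ℕ}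

/-- **`Θ_expl(P, l) ≤ 20·log 2·(d*·l)`**: the closed-form threshold of `LDHGenuineHullRegimeSlackExplicit` is at most
`20·log 2 ≈ 13.9` times `d*·l` (`log(d*·l) ≤ log(2·d*·l)`, `C(P,l) ≥ 0`). [cite: Mochizuki2012, IUTchIV Thm. 1.10 p. 22] -/
theorem explicitThreshold_le (hl : 1 ≤ l) :
    40 * Real.log (((2 ^ 12 * 3 ^ 3 * 5 * Cor22.dmod P : ℕ) : ℝ) * l)
        * ((((2 ^ 12 * 3 ^ 3 * 5 * Cor22.dmod P * l : ℕ) : ℝ)) * Real.log 2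
            / (2 * Real.log (2 * (((2 ^ 12 * 3 ^ 3 * 5 * Cor22.dmod P * l : ℕ) : ℝ))))
          - (2 * (Cor22.dmod P : ℝ) * (P.logDiff + Cor22.logCondAvoid P {2, l}) + Real.log (2 * 3 * 5 * (l : ℝ)))
            / Real.log 2) ≤
      20 * Real.log 2 * (((2 ^ 12 * 3 ^ 3 * 5 * Cor22.dmod P * l : ℕ) : ℝ)) := by
  have hd : 1 ≤ Cor22.dmod P := Cor22.dmod_pos P
  set N : ℕ := 2 ^ 12 * 3 ^ 3 * 5 * Cor22.dmod P * l with hN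
  have hN4 : (4 : ℝ) ≤ (N : ℝ) := by exact_mod_cast (by rw [hN]; nlinarith : 4 ≤ N)
  have hcast : (((2 ^ 12 * 3 ^ 3 * 5 * Cor22.dmod P : ℕ) : ℝ) * l) = (N : ℝ) := by rw [hN]; push_cast; ring
  rw [hcast]
  have hlog2 : (0 : ℝ) < Real.log 2 := Real.log_pos (by norm_num)
  have hlogN : 0 < Real.log (N : ℝ) := Real.log_pos (by linarith)
  have hlog2N : 0 < Real.log (2 * (N : ℝ)) := Real.log_pos (by linarith)
  have hmono : Real.log (N : ℝ) ≤ Real.log (2 * (N : ℝ)) := Real.log_le_log (by linarith) (by linarith)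
  -- `C(P,l) ≥ 0`
  have hC : 0 ≤ (2 * (Cor22.dmod P : ℝ) * (P.logDiff + Cor22.logCondAvoid P {2, l}) + Real.log (2 * 3 * 5 * (l : ℝ)))
      / Real.log 2 := by
    have hl' : (1 : ℝ) ≤ l := by exact_mod_cast hl
    have h1 : 0 ≤ Real.log (2 * 3 * 5 * (l : ℝ)) := Real.log_nonneg (by linarith)
    have h2 : 0 ≤ P.logDiff + Cor22.logCondAvoid P {2, l} := add_nonneg P.logDiff_nonneg (Cor22.logCondAvoid_nonneg P _)
    positivity
  -- drop `C`, then `log N/log(2N) ≤ 1`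
  have h1 : 40 * Real.log (N : ℝ) * ((N : ℝ) * Real.log 2 / (2 * Real.log (2 * (N : ℝ)))
        - (2 * (Cor22.dmod P : ℝ) * (P.logDiff + Cor22.logCondAvoid P {2, l}) + Real.log (2 * 3 * 5 * (l : ℝ)))
          / Real.log 2) ≤
      40 * Real.log (N : ℝ) * ((N : ℝ) * Real.log 2 / (2 * Real.log (2 * (N : ℝ)))) :=
    mul_le_mul_of_nonneg_left (by linarith) (by positivity)
  refine h1.trans ?_
  rw [show 40 * Real.log (N : ℝ) * ((N : ℝ) * Real.log 2 / (2 * Real.log (2 * (N : ℝ)))) =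
      20 * Real.log 2 * (N : ℝ) * (Real.log (N : ℝ) / Real.log (2 * (N : ℝ))) by
    field_simp; ring]
  have hratio : Real.log (N : ℝ) / Real.log (2 * (N : ℝ)) ≤ 1 := (div_le_one hlog2N).mpr hmono
  have h0 : 0 ≤ 20 * Real.log 2 * (N : ℝ) := by positivity
  nlinarith

/-- **HONEST-SCOPE CERTIFICATE: below the explicit (U)-threshold, [IUTchIV] Thm. 1.10's display holds OUTRIGHT.** For any
`λ`-line point `P`, `l ≥ 1`, `η ≥ 0`: if `log(q^{∤{2,l}}(λ)) ≤ Θ_expl(P, l)` (the hypothesis of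
`PointDict.hullVolumeAtDatum_BIII_of_logQAvoid_le_explicit`), then `Cor22.Display P l η` — because
`(1/6)·log q ≤ (20·log 2/6)·d*·l < 20·d*·l ≤ (1 + 20·d_mod/l)·(log-diff + log 𝔣) + 20·(d*·l + η)`. So the height range in
which the kernel proves the volume edge (ii′) in reading (U) without slot-constancy is a range in which the inequality it
serves is content-free. [cite: Mochizuki2012, IUTchIV Thm. 1.10 p. 22–23] [claim: Mochizuki2012, status: disputed] -/
theorem display_of_logQAvoid_le_explicitThreshold (hl : 1 ≤ l)
    (h : Cor22.logQAvoid P {2, l} ≤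
      40 * Real.log (((2 ^ 12 * 3 ^ 3 * 5 * Cor22.dmod P : ℕ) : ℝ) * l)
        * ((((2 ^ 12 * 3 ^ 3 * 5 * Cor22.dmod P * l : ℕ) : ℝ)) * Real.log 2
            / (2 * Real.log (2 * (((2 ^ 12 * 3 ^ 3 * 5 * Cor22.dmod P * l : ℕ) : ℝ))))
          - (2 * (Cor22.dmod P : ℝ) * (P.logDiff + Cor22.logCondAvoid P {2, l}) + Real.log (2 * 3 * 5 * (l : ℝ)))
            / Real.log 2))
    {η : ℝ} (hη : 0 ≤ η) : Cor22.Display P l η := by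
  have hΘ := (h.trans (explicitThreshold_le (P := P) hl))
  have hcast : (((2 ^ 12 * 3 ^ 3 * 5 * Cor22.dmod P * l : ℕ) : ℝ)) = 2 ^ 12 * 3 ^ 3 * 5 * (Cor22.dmod P : ℝ) * l := by
    push_cast; ring
  rw [hcast] at hΘ
  unfold Cor22.Display
  have hlog2 : Real.log 2 ≤ 1 := by
    have := Real.log_two_lt_d9; linarith
  have hLD : 0 ≤ P.logDiff + Cor22.logCondAvoid P {2, l} := add_nonneg P.logDiff_nonneg (Cor22.logCondAvoid_nonneg P _)
  have hl' : (1 : ℝ) ≤ l := by exact_mod_cast hl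
  have hd : (1 : ℝ) ≤ Cor22.dmod P := by exact_mod_cast Cor22.dmod_pos P
  have hcoef : 0 ≤ 1 + 20 * (Cor22.dmod P : ℝ) / l := by positivity
  have hN0 : 0 ≤ (2 : ℝ) ^ 12 * 3 ^ 3 * 5 * (Cor22.dmod P : ℝ) * l := by positivity
  nlinarith [mul_nonneg hcoef hLD, hN0, hΘ, hη, hlog2]

end Cor22

end Literature.IUT.LogVolume

end
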